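import Summits.BirchSwinnertonDyer.BirchSwinnertonDyer.Theorems.KatoDescentPotSupersingularReducibleFineSelmerDescentCount
import HarnessLib

/-!
# Kato's Thm. 14.5 (3) on the fine-Selmer road, SHARP form (the `𝐇²[T]`-factor kept):
# `[H¹(ℤ[1/p],T_pW) : ℤ_p·y₀] = #(H¹(ℤ[1/p],T_pW)/proj₀(𝐇¹_Γ/T)) · [𝐇¹_Γ/T : ȳ]` on the pin, and
# `#Sel₀(W/ℚ_∞)^Γ · #(H¹(ℤ[1/p],T_pW)/proj₀(𝐇¹_Γ/T)) ∣ #Sel₀(W/ℚ_∞)_Γ · [H¹(ℤ[1/p],T_pW) : ℤ_p·𝐲₀]` on the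
# reducible non-CM rank-0 rows of crux M

Seat `bsd-potss-rkm` g16 (prover; cell `bsd-potss`), item stmt-BirchSwinnertonDyer-19196 `ReducibleKatoMember` (crux M of K9
`KatoDescentPotSupersingular` / K8-t′ `KatoDescentTamePotSupersingular`; `--supports … --as helper`; closes nothing).  Sequel of
`…ReducibleFineSelmerDescentCount` (same namespace), which proved `#Sel₀(W/ℚ_∞)^Γ ∣ #Sel₀(W/ℚ_∞)_Γ · [𝐇¹_Γ/T : 𝐲̄]` and
`[𝐇¹_Γ/T : 𝐲̄] ∣ [H¹(ℤ[1/p],T_pW) : ℤ_p 𝐲₀]`.  Here the second divisibility is refined to the EQUALITY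
`[H¹(ℤ[1/p],T_pW) : ℤ_p y₀] = #(descent cokernel) · [𝐇¹_Γ/T : ȳ]` (the tower `ℤ_p y₀ ≤ proj₀(𝐇¹_Γ/T) ≤ H¹(ℤ[1/p],T_pW)`,
`proj₀` injective on `𝐇¹_Γ/T` by Kato's (14.14.1)), where the descent cokernel `H¹(ℤ[1/p],T_pW)/proj₀(𝐇¹_Γ/T)` is the
tree's pinned `IwasawaH1Data.descentCokernel` — on Kato's objects `= 𝐇²(T)⁰[T]` ((14.14.1)); so the headline is the
fine-Selmer reading of `#H²(ℤ[1/p],T) = #𝐇²_Γ ≤ #𝐇²[T] · [𝐇¹_Γ/T : z̄] = [H¹(ℤ[1/p],T) : z]` with NO factor dropped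
(`#𝐇²_Γ/#𝐇²[T] = #Sel₀(W/ℚ_∞)^Γ/#Sel₀(W/ℚ_∞)_Γ` by the Λ-adic Poitou–Tate comparison `X₀ ↪ 𝐇²(T)⁰`, finite cokernel).
Modulo {Kato 13.4, Serre III.7.9 (a), Ferrero–Washington, Lim 3.5} as before.  HONEST FRAMING: BSD is not proved by any
of this; nothing is booked; crux M stays cite-level on {modularity, `Kato2004.exists_memberHullZetaInputs`}.
References: [Kato2004Asterisque] Thm. 14.5 (p. 236), §14.14 (14.14.1)–(14.14.2), Lemma 14.15 (pp. 243–244);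
[GreenbergLNM1716] §4 Lemma 4.2 (p. 102).
-/

-- the summit and its single problem are both named `BirchSwinnertonDyer` (registry layout D-0017)
set_option linter.dupNamespace false
set_option autoImplicit false

noncomputable section

open scoped NumberField TensorProduct
open Field IsDedekindDomain WeierstrassCurve CongruenceSubgroup
open Literature.NumberTheory.GaloisRepresentations Literature.NumberTheory.EllipticCurves
open Literature.NumberTheory.EllipticCurves.ModularForms
open Literature.NumberTheory.EllipticCurves.Kato2004 Literature.NumberTheory.EllipticCurves.Kato2004.EulerSystemValues
open Literature.NumberTheory.EllipticCurves.IwasawaAlgebra Literature.NumberTheory.EllipticCurves.IwasawaDual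

namespace Summit.BirchSwinnertonDyer.BirchSwinnertonDyer.Theorems.ReducibleFineSelmerDescentCount

/-! ## The SHARP form: `[H¹(ℤ[1/p],T_pW) : ℤ_p y₀] = #(descent cokernel) · [𝐇¹_Γ/T : ȳ]`
and `#Sel₀(W/ℚ_∞)^Γ · #(H¹(ℤ[1/p],T_pW)/proj₀(𝐇¹_Γ/T)) ∣ #Sel₀(W/ℚ_∞)_Γ · [H¹(ℤ[1/p],T_pW) : ℤ_p·𝐲₀]`

On Kato's objects `H¹(ℤ[1/p],T)/proj₀(𝐇¹_Γ/T) = 𝐇²(T)⁰[T]` ((14.14.1)) — the tree's pinned `IwasawaH1Data.descentCokernel` —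
so the second statement is the fine-Selmer reading of `#H²(ℤ[1/p],T) = #𝐇²_Γ ≤ #𝐇²[T] · [𝐇¹_Γ/T : z̄] = [H¹(ℤ[1/p],T) : z]`
with NO factor dropped. -/

section Sharp

variable {W : WeierstrassCurve ℚ} [W.IsElliptic] {p : ℕ} [Fact p.Prime]
  [ContinuousSMul ℤ_[p] (W.tateModule p)] {κ : ZpExtension ℚ p} {γ : absoluteGaloisGroup ℚ}

/-- **`[H¹(ℤ[1/p],T_pW) : ℤ_p·y₀] = #(H¹(ℤ[1/p],T_pW)/proj₀(𝐇¹_Γ/T)) · [𝐇¹_Γ/T : ȳ]`** (`y₀ = proj₀ y`; `κ` cyclotomic,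
`γ` a topological generator; `Nat.card`, so no finiteness is assumed): the tower `ℤ_p y₀ ≤ proj₀(𝐇¹_Γ/T) ≤ H¹(ℤ[1/p],T_pW)`
(Lagrange) with `proj₀(𝐇¹_Γ/T)/ℤ_p y₀ ≅ (𝐇¹_Γ/T)/Λȳ`, `proj₀` being injective on `𝐇¹_Γ/T` (Kato's (14.14.1),
`TwistTate.mem_TSubmodule_of_proj_zero_eq_zero`).  On a descent package this is kmc's
`Kato2004.natCard_quotient_eq_of_exact` (`[A : ι z̄] = #H2[T] · [H/TH : z̄]`), here on the bare pin.
[cite: Kato2004Asterisque, §14.14 (14.14.1) (p. 243)] -/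
theorem natCard_quotient_span_eq_natCard_descentCokernel_mul (hκ : κ.IsCyclotomic) (hγ : κ.IsTopGenerator γ)
    (I : IwasawaH1Data W p κ γ) (y : I.H) :
    Nat.card (integralH1 (tateRep W p) p (κ.layerSubgroup 0) ⧸
        Submodule.span ℤ_[p] {(⟨I.proj 0 y, I.proj_mem 0 y⟩ : integralH1 (tateRep W p) p (κ.layerSubgroup 0))}) =
      Nat.card I.descentCokernel *
        Nat.card (coinvariants p I.H ⧸
          Submodule.span (IwasawaAlgebra p) {(Submodule.Quotient.mk y : coinvariants p I.H)}) := by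
  set ybar : coinvariants p I.H := Submodule.Quotient.mk y with hybar
  set y₀ : integralH1 (tateRep W p) p (κ.layerSubgroup 0) := ⟨I.proj 0 y, I.proj_mem 0 y⟩ with hy₀
  set S : Submodule (IwasawaAlgebra p) (coinvariants p I.H) := Submodule.span (IwasawaAlgebra p) {ybar}
  set S' : Submodule ℤ_[p] (integralH1 (tateRep W p) p (κ.layerSubgroup 0)) := Submodule.span ℤ_[p] {y₀}
  -- `proj₀(Λ·ȳ) ⊆ ℤ_p·y₀`
  have hle : S.toAddSubgroup ≤ S'.toAddSubgroup.comap I.projZeroIntegral := by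
    intro w hw
    obtain ⟨g, rfl⟩ := Submodule.mem_span_singleton.mp (show w ∈ S from hw)
    change I.projZeroIntegral (g • ybar) ∈ S'
    refine Submodule.mem_span_singleton.mpr ⟨PowerSeries.constantCoeff g, Subtype.ext ?_⟩
    change PowerSeries.constantCoeff g • I.proj 0 y = (I.projZeroIntegral (g • ybar) : H1 (tateRep W p) _)
    rw [IwasawaH1Data.coe_projZeroIntegral, hybar, ← Submodule.Quotient.mk_smul, IwasawaH1Data.projZero_mk,
      I.proj_zero_smul]
  let ψ := QuotientAddGroup.map S.toAddSubgroup S'.toAddSubgroup I.projZeroIntegral hle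
  -- `ψ` is injective (as in §1)
  have hψ : Function.Injective ψ := by
    rw [injective_iff_map_eq_zero]
    intro q hq
    induction q using QuotientAddGroup.induction_on with
    | H w =>
      have hw : I.projZeroIntegral w ∈ S' := by
        have h1 : ψ (QuotientAddGroup.mk w) = QuotientAddGroup.mk (I.projZeroIntegral w) := rfl
        rw [h1, QuotientAddGroup.eq_zero_iff] at hq
        exact hq
      obtain ⟨c, hc⟩ := Submodule.mem_span_singleton.mp hw
      have hc' : c • I.proj 0 y = I.projZero w := by
        have := congrArg Subtype.val hc
        simpa [hy₀] using this
      rw [QuotientAddGroup.eq_zero_iff]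
      change w ∈ S
      induction w using Submodule.Quotient.induction_on with
      | H x =>
        rw [IwasawaH1Data.projZero_mk] at hc'
        have h0 : I.proj 0 (x - PowerSeries.C c • y) = 0 := by
          rw [map_sub, I.proj_C_smul, hc', sub_self]
        have hT := TwistTate.mem_TSubmodule_of_proj_zero_eq_zero W p κ hκ hγ I _ h0
        have hmk : (Submodule.Quotient.mk x : coinvariants p I.H) = PowerSeries.C c • ybar := by
          rw [hybar, ← Submodule.Quotient.mk_smul, eq_comm, ← sub_eq_zero, ← Submodule.Quotient.mk_sub,
            Submodule.Quotient.mk_eq_zero, ← neg_sub]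
          exact Submodule.neg_mem _ hT
        rw [hmk]
        exact Submodule.smul_mem _ _ (Submodule.mem_span_singleton_self ybar)
  -- the range of `ψ` is `proj₀(𝐇¹_Γ/T)/ℤ_p y₀`
  have hrange : ψ.range = I.projZeroIntegral.range.map (QuotientAddGroup.mk' S'.toAddSubgroup) := by
    rw [AddMonoidHom.map_range]
    apply le_antisymm
    · rintro _ ⟨q, rfl⟩
      induction q using QuotientAddGroup.induction_on with
      | H w => exact ⟨w, rfl⟩
    · rintro _ ⟨w, rfl⟩
      exact ⟨QuotientAddGroup.mk w, rfl⟩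
  -- Lagrange in `A/ℤ_p y₀` along `proj₀(𝐇¹_Γ/T)/ℤ_p y₀`, and the third isomorphism theorem
  have hK : S'.toAddSubgroup ≤ I.projZeroIntegral.range := by
    intro w hw
    obtain ⟨c, rfl⟩ := Submodule.mem_span_singleton.mp (show w ∈ S' from hw)
    refine ⟨PowerSeries.C c • ybar, Subtype.ext ?_⟩
    rw [IwasawaH1Data.coe_projZeroIntegral, hybar, ← Submodule.Quotient.mk_smul, IwasawaH1Data.projZero_mk,
      I.proj_C_smul, Submodule.coe_smul]
  have h3 := AddSubgroup.card_eq_card_quotient_mul_card_addSubgroup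
    (I.projZeroIntegral.range.map (QuotientAddGroup.mk' S'.toAddSubgroup))
  have hq : Nat.card ((integralH1 (tateRep W p) p (κ.layerSubgroup 0) ⧸ S'.toAddSubgroup) ⧸
      I.projZeroIntegral.range.map (QuotientAddGroup.mk' S'.toAddSubgroup)) = Nat.card I.descentCokernel :=
    Nat.card_congr (QuotientAddGroup.quotientQuotientEquivQuotient S'.toAddSubgroup I.projZeroIntegral.range hK).toEquiv
  have hr : Nat.card (I.projZeroIntegral.range.map (QuotientAddGroup.mk' S'.toAddSubgroup)) =
      Nat.card (coinvariants p I.H ⧸ S) := by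
    rw [← hrange]
    exact (Nat.card_congr (AddMonoidHom.ofInjective hψ).toEquiv).symm
  rw [hq, hr] at h3
  exact h3

/-- **On a rank-0 row with `proj₀ y` of infinite order, `H¹(ℤ[1/p],T_pW)/proj₀(𝐇¹_Γ/T)` is finite** (a quotient of
the finite `H¹(ℤ[1/p],T_pW)/ℤ_p y₀`, §1). [cite: Kato2004Asterisque, Thm. 14.5 (1) (p. 236), §14.14 (14.14.1) (p. 243)] -/
theorem finite_descentCokernel_of_not_isOfFinAddOrder [Finite W.toAffine.Point]
    [Finite (AddCommGroup.primaryComponent W.sha p)] (hκ : κ.IsCyclotomic) (hγ : κ.IsTopGenerator γ)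
    (I : IwasawaH1Data W p κ γ) (y : I.H) (hnt : ¬ IsOfFinAddOrder (I.proj 0 y)) :
    Finite I.descentCokernel := by
  haveI := finite_quotient_span_of_not_isOfFinAddOrder I y hnt
  have hne : Nat.card (integralH1 (tateRep W p) p (κ.layerSubgroup 0) ⧸
      Submodule.span ℤ_[p] {(⟨I.proj 0 y, I.proj_mem 0 y⟩ :
        integralH1 (tateRep W p) p (κ.layerSubgroup 0))}) ≠ 0 := Nat.card_pos.ne'
  rw [natCard_quotient_span_eq_natCard_descentCokernel_mul hκ hγ I y] at hne
  exact Nat.finite_of_card_ne_zero (left_ne_zero_of_mul hne)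

end Sharp

section SharpRows

variable (W : WeierstrassCurve ℚ) [W.IsElliptic] (p : ℕ) [Fact p.Prime]
  [ContinuousSMul ℤ_[p] (W.tateModule p)] [Module.Free ℤ_[p] (W.tateModule p)]
  [Module.Finite ℤ_[p] (W.tateModule p)]
  [Finite W.toAffine.Point] [Finite (AddCommGroup.primaryComponent W.sha p)]
  {κ : ZpExtension ℚ p} {γ : absoluteGaloisGroup ℚ}

/-- **Kato Thm. 14.5 (3) on the fine road, SHARP form, reducible non-CM rank-0 rows**: for a genuine Λ-adic
Euler-system class `s` with `proj₀ s` of infinite order,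
**`#Sel₀(W/ℚ_∞)^Γ · #(H¹(ℤ[1/p],T_pW)/proj₀(𝐇¹_Γ/T)) ∣ #Sel₀(W/ℚ_∞)_Γ · [H¹(ℤ[1/p],T_pW) : ℤ_p·s₀]`**, all four
finite, modulo {13.4, Serre, FW, Lim 3.5} — the reading of `#𝐇²_Γ ≤ #𝐇²[T] · [𝐇¹_Γ/T : s̄]` with `𝐇²[T]` kept
(§2 combined with `natCard_quotient_span_eq_natCard_descentCokernel_mul`).
[cite: Kato2004Asterisque, Thm. 14.5 (3) (p. 236), §14.14 (14.14.1)–(14.14.2) and Lemma 14.15 (pp. 243–244)]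
[cite: GreenbergLNM1716, §4 Lemma 4.2 (p. 102)] -/
theorem natCard_fineSelmer_invariants_mul_descentCokernel_dvd_of_isEulerSystemClass_of_not_irreducible
    (h134 : thm13_4_lengthAt_fineSelmerDual_le_of_isEulerSystemClass)
    (hSerre : serre_adicImage_contains_congruenceSubgroup)
    (hLim : Lim2017.thm35_fineSelmerDual_moduleFinite_of_classicalMuVanishes_of_le_divisionField)
    (hFW : Literature.NumberTheory.IwasawaTheory.ferreroWashington1979_classicalMuVanishes)
    (hp : p ≠ 2) (hκ : κ.IsCyclotomic) (hγ : κ.IsTopGenerator γ) (hCM : ¬ W.HasCM)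
    (hred : ¬ W.HasIrreducibleModPGaloisRep p) (I : IwasawaH1Data W p κ γ) (Y : W.FineSelmerDualData κ γ)
    (s : I.H) (hs : IsEulerSystemClass W p κ γ I s) (hnt : ¬ IsOfFinAddOrder (I.proj 0 s)) :
    Finite (endInvariants (W.conjFineSelmerInfty κ γ - 1)) ∧
      Finite (EndCoinvariants (W.conjFineSelmerInfty κ γ - 1)) ∧ Finite I.descentCokernel ∧
      Finite (integralH1 (tateRep W p) p (κ.layerSubgroup 0) ⧸
        Submodule.span ℤ_[p] {(⟨I.proj 0 s, I.proj_mem 0 s⟩ : integralH1 (tateRep W p) p (κ.layerSubgroup 0))}) ∧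
      Nat.card (endInvariants (W.conjFineSelmerInfty κ γ - 1)) * Nat.card I.descentCokernel ∣
        Nat.card (EndCoinvariants (W.conjFineSelmerInfty κ γ - 1)) *
          Nat.card (integralH1 (tateRep W p) p (κ.layerSubgroup 0) ⧸
            Submodule.span ℤ_[p] {(⟨I.proj 0 s, I.proj_mem 0 s⟩ :
              integralH1 (tateRep W p) p (κ.layerSubgroup 0))}) := by
  obtain ⟨h1, h2, h3⟩ := natCard_fineSelmer_invariants_dvd_of_isEulerSystemClass_of_not_irreducible W p h134
    hSerre hLim hFW hp hκ hγ hCM hred I Y s hs hnt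
  refine ⟨h1, h2, finite_descentCokernel_of_not_isOfFinAddOrder hκ hγ I s hnt,
    finite_quotient_span_of_not_isOfFinAddOrder I s hnt, ?_⟩
  rw [natCard_quotient_span_eq_natCard_descentCokernel_mul hκ hγ I s, mul_left_comm _ (Nat.card I.descentCokernel),
    mul_comm _ (Nat.card I.descentCokernel)]
  exact mul_dvd_mul_left _ h3

/-- **The sharp form for Kato's own zeta lift** (value-guarded `ZetaBody` family whose `f` is the newform of a curve
`V` with `L(V,1) ≠ 0`): `#Sel₀(W/ℚ_∞)^Γ · #(H¹(ℤ[1/p],T_pW)/proj₀(𝐇¹_Γ/T)) ∣ #Sel₀(W/ℚ_∞)_Γ · [H¹(ℤ[1/p],T_pW) : ℤ_p·𝐲₀]`,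
all finite, modulo {13.4, Serre, FW, Lim 3.5}. [cite: Kato2004Asterisque, Thm. 14.5 (2)–(3) (p. 236), §14.14 (pp. 243–244)]
[cite: GreenbergLNM1716, §4 Lemma 4.2 (p. 102)] -/
theorem natCard_fineSelmer_invariants_mul_descentCokernel_dvd_zetaLift
    (h134 : thm13_4_lengthAt_fineSelmerDual_le_of_isEulerSystemClass)
    (hSerre : serre_adicImage_contains_congruenceSubgroup)
    (hLim : Lim2017.thm35_fineSelmerDual_moduleFinite_of_classicalMuVanishes_of_le_divisionField)
    (hFW : Literature.NumberTheory.IwasawaTheory.ferreroWashington1979_classicalMuVanishes)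
    (hp : p ≠ 2) (hκ : κ.IsCyclotomic) (hγ : κ.IsTopGenerator γ) (hCM : ¬ W.HasCM)
    (hred : ¬ W.HasIrreducibleModPGaloisRep p) (I : IwasawaH1Data W p κ γ) (Y : W.FineSelmerDualData κ γ)
    {N : ℕ} [NeZero N] {f : CuspForm (Gamma0 N) 2}
    {ι : (m : ℕ) → (CyclotomicField m ℚ →+* ℂ)} {κ' : ℝ}
    {Λ' : ∀ (k : ℕ) (r : Finset (HeightOneSpectrum (𝓞 ℚ))),
      H1 (tateRep W p) (cycSubgroup p k r) →ₗ[ℤ_[p]] ℚ_[p] ⊗[ℚ] CyclotomicField (cycLevel p k r) ℚ}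
    {c d a : ℤ} {A : ℕ}
    {z : ∀ (k : ℕ) (r : (cyclotomicLevelsRat p (badPlaces c d A N)).Ideals),
      H1 (tateRep W p) ((cyclotomicLevelsRat p (badPlaces c d A N)).level k r.1)}
    {x : ∀ (k : ℕ) (r : (cyclotomicLevelsRat p (badPlaces c d A N)).Ideals),
      CyclotomicField (cycLevel p k r.1) ℚ}
    (hbody : ZetaBody W p f ι κ' Λ' c d a A z x) (hne : 2 * c.natAbs * d.natAbs * A * N ≠ 0)
    {y : I.H} (hy : ∀ n : ℕ, I.proj n y = levelToLayer W p hκ hp (badPlaces c d A N) n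
      (z (n + 1) (cyclotomicLevelsRat p (badPlaces c d A N)).idealOne))
    {V : WeierstrassCurve ℚ} [V.IsElliptic] (hf : IsNewformOf V f) (hL1 : V.entireLFunction 1 ≠ 0)
    (hκ' : κ' ≠ 0) (hA : 0 < A) (d' : ℤ) (hcd : Int.gcd (c * d) A = 1) (hdd' : d * d' ≡ 1 [ZMOD (A : ℤ)])
    (hR : cuspFactor f true (fun _ ↦ 1) c d a A d' ≠ 0) :
    Finite (endInvariants (W.conjFineSelmerInfty κ γ - 1)) ∧
      Finite (EndCoinvariants (W.conjFineSelmerInfty κ γ - 1)) ∧ Finite I.descentCokernel ∧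
      Finite (integralH1 (tateRep W p) p (κ.layerSubgroup 0) ⧸
        Submodule.span ℤ_[p] {(⟨I.proj 0 y, I.proj_mem 0 y⟩ : integralH1 (tateRep W p) p (κ.layerSubgroup 0))}) ∧
      Nat.card (endInvariants (W.conjFineSelmerInfty κ γ - 1)) * Nat.card I.descentCokernel ∣
        Nat.card (EndCoinvariants (W.conjFineSelmerInfty κ γ - 1)) *
          Nat.card (integralH1 (tateRep W p) p (κ.layerSubgroup 0) ⧸
            Submodule.span ℤ_[p] {(⟨I.proj 0 y, I.proj_mem 0 y⟩ :
              integralH1 (tateRep W p) p (κ.layerSubgroup 0))}) :=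
  natCard_fineSelmer_invariants_mul_descentCokernel_dvd_of_isEulerSystemClass_of_not_irreducible W p h134 hSerre hLim
    hFW hp hκ hγ hCM hred I Y y (isEulerSystemClass_of_zetaBody W p hκ hp I hbody hne hy)
    (MemberIndexOfValue.not_isOfFinAddOrder_proj_zero_of_zetaBody hκ hp hbody hκ' hf hL1 hA d' hcd hdd' hR hy)

end SharpRows

end Summit.BirchSwinnertonDyer.BirchSwinnertonDyer.Theorems.ReducibleFineSelmerDescentCount

end
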